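import Summits.QuantumFields.QCD.Theorems.HeatSlicedQuarksRobustYangMillsHandoverStubDetDiracMatrixSourceHasDerivAtSmit
import Summits.QuantumFields.QCD.Theorems.HeatSlicedQuarksRobustYangMillsHandoverStubFermiIntegralSourcesDet
import Summits.QuantumFields.QCD.Theorems.QuarksAsStableActionStableActionBridgeGluonicExpectation
import HarnessLib

/-!
# Stub `stub_fermiIntegral_bilinear_cyclic_supertrace` of line `pin-the-infimum`
(crux `RobustYangMillsHandover`, 8892)

E2 (fermionic insertions in Lüscher's transfer form), layer E2-d(1): **the one-bilinear Berezin
identity per background and its Haar-weighted gauge average as a cyclic kernel supertrace with ONE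
link-free Fock insertion** (the capstone-C analogue with an insertion).

For an `SU(3)` gauge field `U` on the four-torus `(ℤ/L)⁴`, `N_f` flavours of `r = 1` Wilson quarks
with masses `mq f > −1`, a time slice `t₀` and a source block `Jh` on the quark variables of that
slice (torus-level equal-time source `Jt t₀ Jh`), with `ε = (−1)^{n(n−1)/2 + n}`, `n` the number of
quark variables:

(a) `∫dψ̄dψ (ψ̄ Jt ψ) e^{−ψ̄D(U)ψ} = ε · Σ_S (−1)^{#S} ⟨S| ∏_i 𝒦_i · (T̂_F(U_i) Γ(G_{g_i})) |S⟩`, the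
link-free insertion `𝒦_{t₀} = ins (U_{t₀}) Jh = dΓ(V⁻¹ K̂_J V) − tr(Jh Â⁻¹ P̂⁻) · 1` of the landed
one-source theorem `stub_det_diracMatrix_source_hasDerivAt_smit` sitting in front of the
slice-`t₀` factor (`𝒦_i = 1` otherwise): both sides are the `s`-derivative at `0` of
`ε det (D(U) − s Jt)` (the Berezin source identity `stub_fermiIntegral_sources_det`, conjunct 2, and
the one-source theorem), so they agree by uniqueness of derivatives.

(b) `∫ e^{−β S_W(U)} ∫dψ̄dψ (ψ̄ Jt ψ) e^{−ψ̄D(U)ψ} ∏_e dU_e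
   = ε ∫∫ ∏_t K_β(Us t, (Us (t+1))^{gs t})
        · Σ_S (−1)^{#S} ⟨S| ∏_i 𝒦_i(Us t₀) T̂_F(Us i) Γ(G_{gs i}) |S⟩ dUs dgs`:
the insertion is a function of the slice-`t₀` spatial links only, so the transport along the
time-assembling map `asm (Us, gs)` is that of capstone C
(`qcd_boltzmann_integral_eq_cyclic_supertrace_flavour`): the assembling map is measure preserving
(`stub_timeSlicing`) and a measurable embedding (its inverse is the pair of slice maps,
`timeSlice_of_timeAssemble`), so `∫ F dU = ∫ F ∘ asm` for every integrand
(`MeasurePreserving.integral_comp`; the sign `ε` is pulled out with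
`GluonicExpectation.integral_weight_mul_const_mul`); pointwise, `e^{−β S_W(asm p)} = ∏_t K_β`
(the landed `CyclicSupertrace.exp_wilsonAction_timeAssemble`) and (a) at `U = asm p` read through the slicing
dictionary (`U_t (asm p) = p.1 t`, `g_t (asm p) = p.2 t`).

Pure theorem file (no definitions).  References: M. Lüscher, Comm. Math. Phys. 54 (1977) 283–292;
K. Osterwalder, E. Seiler, Ann. Phys. 110 (1978) 440, §2; J. Smit, *Introduction to Quantum Fields
on a Lattice* (CUP 2002/2023), §4.6, §6.5 (6.91); I. Montvay, G. Münster, *Quantum Fields on a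
Lattice* (CUP 1994), §4.1 (4.14)–(4.17), §5.1.
-/

noncomputable section

namespace Summit.QuantumFields.QCD.Cruxes.RobustYangMillsHandover.PinTheInfimum

open Literature.MathematicalPhysics.QuantumLattice Literature.MathematicalPhysics.QuantumFieldTheory
open Literature.Probability.LatticeModels (TorusSite)
open MeasureTheory
open Summit.QuantumFields.QCD.Cruxes.StableActionBridge.Sketch

namespace StubFermiIntegralBilinearCyclicSupertrace

/-- `A` together with `A → B` gives `A ∧ B` (conjunct (b) is assembled from conjunct (a)). [folklore] -/
theorem and_of_imp {A B : Prop} (ha : A) (hb : A → B) : A ∧ B := ⟨ha, hb ha⟩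

/-- **Uniqueness of derivatives**: if `f' (0) = v` and `(ε f)' (0) = w` then `w = ε v`. [folklore] -/
theorem eq_const_mul_of_hasDerivAt {f : ℝ → ℂ} {ε v w : ℂ} (ha : HasDerivAt f v 0)
    (hb : HasDerivAt (fun s : ℝ => ε * f s) w 0) : w = ε * v :=
  hb.unique (ha.const_mul ε)

/-- **The time-assembling map is onto**: every four-torus configuration is assembled from its own
time slices (spatial links `e ↦ U (Fin.cons t e.1, e.2.succ)`, temporal links `y ↦ U (Fin.cons t y, 0)`).
[folklore] -/
theorem timeAssemble_surjective (N : ℕ) (G : Type) :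
    Function.Surjective fun p : (ZMod N → GaugeConfig 3 N G) × (ZMod N → TorusSite 3 N → G) =>
      fun e : Edge 4 N =>
        (Fin.cons (p.2 (e.1 0) (Fin.tail e.1)) (fun i : Fin 3 => p.1 (e.1 0) (Fin.tail e.1, i)) :
          Fin 4 → G) e.2 := by
  intro U
  refine ⟨(fun (t : ZMod N) (e : Edge 3 N) => U ((Fin.cons t e.1 : TorusSite 4 N), e.2.succ),
    fun (t : ZMod N) (y : TorusSite 3 N) => U ((Fin.cons t y : TorusSite 4 N), 0)), funext fun e => ?_⟩
  obtain ⟨x, μ⟩ := e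
  refine Fin.cases ?_ (fun i => ?_) μ
  · simp only [Fin.cons_zero, Fin.cons_self_tail]
  · simp only [Fin.cons_succ, Fin.cons_self_tail]

/-- **The time-assembling map is a measurable embedding** of the product of the slice configuration
spaces into the four-torus configuration space: it is measurable (`stub_timeSlicing`), onto, and the
pair of (measurable) slice maps is a left inverse (`timeSlice_of_timeAssemble`). [folklore] -/
theorem measurableEmbedding_timeAssemble (N : ℕ) [NeZero N] :
    MeasurableEmbedding fun p : (ZMod N → GaugeConfig 3 N (Matrix.specialUnitaryGroup (Fin 3) ℂ)) ×
        (ZMod N → TorusSite 3 N → Matrix.specialUnitaryGroup (Fin 3) ℂ) => fun e : Edge 4 N =>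
      (Fin.cons (p.2 (e.1 0) (Fin.tail e.1)) (fun i : Fin 3 => p.1 (e.1 0) (Fin.tail e.1, i)) :
        Fin 4 → Matrix.specialUnitaryGroup (Fin 3) ℂ) e.2 := by
  refine MeasurableEmbedding.of_measurable_inverse
    (g := fun U : GaugeConfig 4 N (Matrix.specialUnitaryGroup (Fin 3) ℂ) =>
      ((fun (t : ZMod N) (e : Edge 3 N) => U ((Fin.cons t e.1 : TorusSite 4 N), e.2.succ)),
        fun (t : ZMod N) (y : TorusSite 3 N) => U ((Fin.cons t y : TorusSite 4 N), 0)))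
    (Summit.QuantumFields.YangMills.Theorems.WeakCouplingHypercubicLimit.TraceNormColdPressure.stub_timeSlicing
      N (Matrix.specialUnitaryGroup (Fin 3) ℂ) (fundamentalRep (Fin 3))).1.measurable ?_ (by fun_prop) ?_
  · rw [Set.range_eq_univ.mpr (timeAssemble_surjective N (Matrix.specialUnitaryGroup (Fin 3) ℂ))]
    exact MeasurableSet.univ
  · intro p
    exact Prod.ext (funext fun t => (timeSlice_of_timeAssemble N _ p.1 p.2 t).1)
      (funext fun t => (timeSlice_of_timeAssemble N _ p.1 p.2 t).2)

end StubFermiIntegralBilinearCyclicSupertrace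

/-- **E2-d(1): the one-bilinear Berezin identity and its Haar-weighted gauge average as a cyclic
kernel supertrace with ONE link-free Fock insertion.**  For `SU(3)` gauge fields on `(ℤ/L)⁴`,
`N_f` flavours of `r = 1` Wilson quarks with masses `mq f > −1`, a slice `t₀` and a source block `Jh`
(torus-level equal-time source `Jt t₀ Jh`), `ε = (−1)^{n(n−1)/2 + n}`:
(a) per background, `∫dψ̄dψ (ψ̄ Jt ψ) e^{−ψ̄D(U)ψ} = ε · STr ∏_i 𝒦_i T̂_F(U_i) Γ(G_{g_i})` with the
link-free insertion `𝒦_{t₀} = ins (U_{t₀}) Jh` of `stub_det_diracMatrix_source_hasDerivAt_smit`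
(uniqueness of derivatives against the Berezin source identity `stub_fermiIntegral_sources_det`);
(b) `∫ e^{−β S_W} ∫dψ̄dψ (ψ̄ Jt ψ) e^{−ψ̄Dψ} dU
      = ε ∫∫ ∏_t K_β(Us t, (Us (t+1))^{gs t}) · STr ∏_i 𝒦_i(Us t₀) T̂_F(Us i) Γ(G_{gs i}) dUs dgs`
— Lüscher's transfer form of a meson one-point numerator at kernel level, transported along the
measure-preserving time-assembling map exactly as capstone C (registered stub signature verbatim,
header on one line).  [cite: Luscher1977, pp. 283–292] [cite: OsterwalderSeiler1978, §2] -/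
theorem stub_fermiIntegral_bilinear_cyclic_supertrace : ∀ (Nf L : ℕ) [NeZero L] (β : ℝ) (mq : Fin Nf → ℝ), (∀ f, -1 < mq f) → ∀ (t₀ : ZMod L) (Jh : Matrix (SliceQuarkVar Nf L) (SliceQuarkVar Nf L) ℂ), let Jt : ZMod L → Matrix (SliceQuarkVar Nf L) (SliceQuarkVar Nf L) ℂ → Matrix (FermiIdx Nf L) (FermiIdx Nf L) ℂ := fun t J => Matrix.reindex quarkEquiv quarkEquiv (Matrix.of fun v w : QuarkVar Nf L => if v.2.1 0 = t ∧ w.2.1 0 = t then J (v.1, (Fin.tail v.2.1, v.2.2)) (w.1, (Fin.tail w.2.1, w.2.2)) else 0); let ins : GaugeConfig 3 L (Matrix.specialUnitaryGroup (Fin 3) ℂ) → Matrix (SliceQuarkVar Nf L) (SliceQuarkVar Nf L) ℂ → Matrix (Finset (SliceFermiIdx Nf L)) (Finset (SliceFermiIdx Nf L)) ℂ := fun V J => dGamma (Matrix.reindex sliceQuarkEquiv sliceQuarkEquiv (sliceKron (Nf := Nf) (S := L) 1 (gammaFive * euclideanGamma 0) * ((-sliceKron (Nf := Nf) (S := L)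 1 timeProjPlus + sliceKron (Nf := Nf) (S := L) 1 timeProjPlus * (sliceKron (Nf := Nf) (S := L) 1 (euclideanGamma 0) * sliceDiracKinetic V) * sliceKron ((sliceMassHop V mq)⁻¹) 1 * sliceKron (Nf := Nf) (S := L) 1 timeProjMinus + sliceKron ((sliceMassHop V mq)⁻¹) 1 * sliceKron (Nf := Nf) (S := L) 1 timeProjMinus) * J * (sliceKron (Nf := Nf) (S := L) 1 timeProjMinus + sliceKron (Nf := Nf) (S := L) 1 timeProjPlus * (sliceKron (Nf := Nf) (S := L) 1 (euclideanGamma 0 * gammaFive) * (fermionSliceMatrix V mq)⁻¹ * sliceKron (Nf := Nf) (S := L) 1 (gammaFive * euclideanGamma 0)))) * sliceKron (Nf := Nf) (S := L) 1 (euclideanGamma 0 * gammaFive))) - (J * sliceKron ((sliceMassHop V mq)⁻¹) 1 * sliceKron (Nf := Nf) (S := L) 1 timeProjMinus).trace • (1 : Matrix (Finset (SliceFermiIdx Nf L)) (Finset (SliceFermiIdx Nf L)) ℂ); (∀ U : GaugeConfig 4 L (Matrix.specialUnitaryGroup (Fin 3) ℂ), fermiIntegral (quadratic ℂ (Jt t₀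 Jh) * fermiBoltzmann U mq) = (-1 : ℂ) ^ (Fintype.card (FermiIdx Nf L) * (Fintype.card (FermiIdx Nf L) - 1) / 2 + Fintype.card (FermiIdx Nf L)) * ∑ S : Finset (SliceFermiIdx Nf L), (-1 : ℂ) ^ S.card * ((((List.range L).map fun i : ℕ => (if (i : ZMod L) = t₀ then ins (fun e : Edge 3 L => U ((Fin.cons t₀ e.1 : TorusSite 4 L), e.2.succ)) Jh else 1) * (fermionSliceOp (fun e : Edge 3 L => U ((Fin.cons (i : ZMod L) e.1 : TorusSite 4 L), e.2.succ)) mq * fockGaugeAct (Nf := Nf) (fun y : TorusSite 3 L => U ((Fin.cons (i : ZMod L) y : TorusSite 4 L), 0)))).prod : Matrix (Finset (SliceFermiIdx Nf L)) (Finset (SliceFermiIdx Nf L)) ℂ) S S)) ∧ ∫ U : GaugeConfig 4 L (Matrix.specialUnitaryGroup (Fin 3) ℂ), (Real.exp (-(β * wilsonAction (fundamentalRep (Fin 3)) U)) : ℂ) * fermiIntegral (quadratic ℂ (Jt t₀ Jh) * fermiBoltzmann U mq) ∂(Measure.pi fun _ : Edge 4 L => haarProbability (Matrix.specialUnitaryGroup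 (Fin 3) ℂ)) = (-1 : ℂ) ^ (Fintype.card (FermiIdx Nf L) * (Fintype.card (FermiIdx Nf L) - 1) / 2 + Fintype.card (FermiIdx Nf L)) * ∫ p : (ZMod L → GaugeConfig 3 L (Matrix.specialUnitaryGroup (Fin 3) ℂ)) × (ZMod L → TorusSite 3 L → Matrix.specialUnitaryGroup (Fin 3) ℂ), ((∏ t : ZMod L, gaugeSliceKernel β (p.1 t) (gaugeTransform (p.2 t) (p.1 (t + 1))) : ℝ) : ℂ) * ∑ S : Finset (SliceFermiIdx Nf L), (-1 : ℂ) ^ S.card * ((((List.range L).map fun i : ℕ => (if (i : ZMod L) = t₀ then ins (p.1 t₀) Jh else 1) * (fermionSliceOp (p.1 (i : ZMod L)) mq * fockGaugeAct (Nf := Nf) (p.2 (i : ZMod L)))).prod : Matrix (Finset (SliceFermiIdx Nf L)) (Finset (SliceFermiIdx Nf L)) ℂ) S S) ∂((Measure.pi fun _ : ZMod L => Measure.pi fun _ : Edge 3 L => haarProbability (Matrix.specialUnitaryGroup (Fin 3) ℂ)).prod (Measure.pi fun _ : ZMod L => Measure.pi fun _ : TorusSite 3 L => haarProbability (Matrix.specialUnitaryGroup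 (Fin 3) ℂ))) := by
  intro Nf L _ β mq hm t₀ Jh Jt ins
  refine StubFermiIntegralBilinearCyclicSupertrace.and_of_imp (fun U => ?_) fun ha => ?_
  · /- (a): both sides are `d/ds|₀ ε det (D(U) − s Jt)` (Berezin source identity, conjunct 2, and the
      one-source theorem in Smit's vocabulary); uniqueness of derivatives. -/
    exact StubFermiIntegralBilinearCyclicSupertrace.eq_const_mul_of_hasDerivAt
      (stub_det_diracMatrix_source_hasDerivAt_smit Nf L U mq hm t₀ Jh)
      (stub_fermiIntegral_sources_det Nf L U mq (Jt t₀ Jh) 0).2.1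
  · /- (b): transport along the time-assembling map (measure preserving, measurable embedding), then
      the pointwise identity: `e^{−β S_W(asm p)} = ∏_t K_β` and (a) at `U = asm p` read through the
      slicing dictionary. -/
    obtain ⟨hasm, -⟩ :=
      Summit.QuantumFields.YangMills.Theorems.WeakCouplingHypercubicLimit.TraceNormColdPressure.stub_timeSlicing
        L (Matrix.specialUnitaryGroup (Fin 3) ℂ) (fundamentalRep (Fin 3))
    rw [← hasm.integral_comp
        (StubFermiIntegralBilinearCyclicSupertrace.measurableEmbedding_timeAssemble L),
      ← GluonicExpectation.integral_weight_mul_const_mul]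
    refine integral_congr_ae (ae_of_all _ fun p => ?_)
    dsimp only
    rw [CyclicSupertrace.exp_wilsonAction_timeAssemble L β p.1 p.2, ha]
    simp only [Fin.cons_succ, Fin.cons_zero, Fin.tail_cons, Prod.mk.eta]

end Summit.QuantumFields.QCD.Cruxes.RobustYangMillsHandover.PinTheInfimum

end
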